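import Literature.NumberTheory.GaloisRepresentations.LubinTateUnramifiedTowerIwasawa
import HarnessLib

/-!
# The two-variable Coleman transform at `q = 2`: norm-coherent units of the tower `⋃_m E_m·K_π^∞` ↪ `𝒪_F⟦X⟧⟦Y⟧`
# (`X = φ − 1` the unramified variable, `Y` the Lubin–Tate coordinate), injective on principal families

De Shalit, *Iwasawa theory of elliptic curves with complex multiplication* (1987), Ch. I §3.7–3.8 (17), Ch. III §1.3: the structure of the
semi-local units of the two-variable tower as a module over the two-variable Iwasawa algebra.  Assembling the tree's series-currency
pieces for a `ℤ_p`-tower `E₀ ≤ E₁ ≤ ⋯ ⊆ F^{nr}` (`[E_m:F] = p^m`, trace-coherent integral normal generators `θ_m`, `q = |𝓀_F| = 2`,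
`π = 2u`): a trace-coherent family of coordinate series `r_m ∈ 𝒪_{E_m}⟦Y⟧` is, coefficient by coefficient in `Y`, a trace-coherent family of
elements of `𝒪_{E_m}`, hence (`LubinTateUnramifiedTowerIwasawa`) ONE power series in `X` over `𝒪_F`; altogether ONE element of
`𝒪_F⟦X⟧⟦Y⟧ = PowerSeries (PowerSeries 𝒪_F)` — the shape of the tree's `IwasawaAlgebra₂` (`ℤ_p⟦T₂⟧⟦T₁⟧`):

* ★★ `existsUnique_series_amice_of_traceCoherent` — every trace-coherent family of series `(r_m)` has a unique transform
  `G ∈ PowerSeries (PowerSeries 𝒪_F)` (`coeff_k G ≡ Σ_i a_{coeff_k r_m}(φ_m^i)(1+X)^i (mod ω_m)` for all `m, k`);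
* ★★★ `existsUnique_colemanTransform₂` — **the two-variable Coleman transform**: for a baseNorm-coherent family `β = (β_m ∈ 𝒰(E_m·K_π^∞))`
  (a norm-coherent unit of the two-variable tower) the coordinate family `(r_{β_m})` is trace-coherent (`unitBallTrace_coeff_relUnitCoordTwo`),
  so `β` has a unique transform `Col(β) ∈ 𝒪_F⟦X⟧⟦Y⟧`; ★★ `eq_of_colemanTransform₂_eq` — **`Col` is injective on principal families**
  (`u^{[E_m:F]} ≠ 1`);
* ★ `colemanTransform₂_frob` — the unramified Frobenius (`σ₀` acting on the family) multiplies `Col` by `C(1 + X)`: the `X`-variable IS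
  `φ − 1`, the first variable of the two-variable Iwasawa algebra.

Everything PROVED (0 sorry, no named facts, no new definitions).  The `Y`-variable is the Coleman coordinate, NOT yet the second Iwasawa
variable: the Lubin–Tate direction acts on it by `v ⋆ r = vρ_v(r ∘ [v])` (pro-unipotently, `LubinTateColemanCoordUnipotentTwo`); its
identification with `𝒪_F[Δ]⟦T₂⟧` is the remaining half of the `Λ₂`-structure.

## References

* E. de Shalit, *Iwasawa theory of elliptic curves with complex multiplication* (1987), Ch. I §3.7–3.8 (17); Ch. III §1.3. [deShalit1987]
-/

noncomputable section

open scoped PowerSeries.WithPiTopology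

namespace Literature.NumberTheory.GaloisRepresentations

section TwoVariableTransformTwo

open GaloisRepresentations.IsNonarchimedeanLocalField LubinTate ValuativeRel Field Finset
open Literature.NumberTheory.EllipticCurves.IwasawaOmega

variable {F : Type} [Field F] [ValuativeRel F] [TopologicalSpace F] [IsNonarchimedeanLocalField F]

attribute [local instance] ltNormUniformSpace ltNormIsUniformAddGroup rk1 nF nE fintypeResidueField

variable (p : ℕ) [hp : Fact p.Prime]
variable {π : 𝒪[F]} (hπ : (valuation F).IsUniformizer (π : F))
variable (E : ℕ → IntermediateField F (AlgebraicClosure F)) [∀ m, FiniteDimensional F (E m)] [∀ m, Normal F (E m)]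
  [∀ m, IsGalois F (E m)] (hmono : Monotone E) (hE : ∀ m, E m ≤ maxUnramified F) (hdeg : ∀ m, Module.finrank F (E m) = p ^ m)
  {σ₀ : absoluteGaloisGroup F} (hσ₀ : IsAbsArithFrob σ₀)

/-! ### Trace-coherent families of series ↦ `PowerSeries (PowerSeries 𝒪_F)` -/

include hE hdeg hσ₀ in
/-- ★★ **The transform of a trace-coherent family of SERIES** (coefficientwise `existsUnique_amice_of_traceCoherent`): for trace-coherent
generators `θ` and series `r_m ∈ 𝒪_{E_m}⟦Y⟧` with `Tr r_{m+1} = r_m` coefficientwise, there is a unique `G ∈ PowerSeries (PowerSeries 𝒪_F)`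
(outer variable `Y`, inner variable `X`) with `coeff_k G ≡ Σ_{i ∈ ℤ/p^m} a_{coeff_k r_m}(φ_m^i)·(1+X)^i (mod ω_m)` for all `m, k`.
[cite: deShalit1987, Ch. I §3.8 (17)] -/
theorem existsUnique_series_amice_of_traceCoherent [IsAdicComplete (Ideal.span {(p : 𝒪[F])}) 𝒪[F]] {θ : ∀ m, unitBall (E m)}
    (hθ : ∀ m, IsIntegralNormalGen (E m) (θ m)) (hcoh : ∀ m, unitBallTrace (hmono (Nat.le_succ m)) (θ (m + 1)) = θ m)
    (r : ∀ m, PowerSeries (unitBall (E m)))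
    (hr : ∀ m k, unitBallTrace (hmono (Nat.le_succ m)) (PowerSeries.coeff k (r (m + 1))) = PowerSeries.coeff k (r m)) :
    ∃! G : PowerSeries (PowerSeries 𝒪[F]), ∀ m k, ((1 + PowerSeries.X : PowerSeries 𝒪[F]) ^ p ^ m - 1) ∣
      PowerSeries.coeff k G - ∑ i : ZMod (p ^ m), PowerSeries.C ((hθ m).basis.repr (PowerSeries.coeff k (r m))
        (((absoluteGaloisGroup.toAlgEquiv F σ₀).restrictNormal (E m)) ^ i.val)) * (1 + PowerSeries.X) ^ i.val := by
  have hk := fun k => existsUnique_amice_of_traceCoherent p E hmono hE hdeg hσ₀ hθ hcoh (fun m => PowerSeries.coeff k (r m))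
    (fun m => hr m k)
  choose g hg using fun k => (hk k).exists
  refine ⟨PowerSeries.mk g, fun m k => by rw [PowerSeries.coeff_mk]; exact hg k m, fun G' hG' => PowerSeries.ext fun k => ?_⟩
  rw [PowerSeries.coeff_mk]
  exact (hk k).unique (fun m => hG' m k) (hg k)

/-! ### The two-variable Coleman transform of a norm-coherent unit of the tower -/

variable (hq : residueFieldCard F = 2)

include hdeg in
/-- ★★★ **The two-variable Coleman transform exists and is unique**: for a baseNorm-coherent family `β = (β_m ∈ 𝒰(E_m·K_π^∞))_m` — a
norm-coherent unit of the two-variable tower `⋃_m E_m·K_π^∞` — there is a unique `Col(β) ∈ PowerSeries (PowerSeries 𝒪_F)` with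
`coeff_k Col(β) ≡ Σ_i a_{coeff_k r_{β_m}}(φ_m^i)(1+X)^i (mod ω_m)` for all `m, k` (the coordinates `r_{β_m}` are trace-coherent by
`unitBallTrace_coeff_relUnitCoordTwo`). [cite: deShalit1987, Ch. I §3.7–3.8 (17); Ch. III §1.3] -/
theorem existsUnique_colemanTransform₂ [IsAdicComplete (Ideal.span {(p : 𝒪[F])}) 𝒪[F]] {θ : ∀ m, unitBall (E m)}
    (hθ : ∀ m, IsIntegralNormalGen (E m) (θ m)) (hcoh : ∀ m, unitBallTrace (hmono (Nat.le_succ m)) (θ (m + 1)) = θ m)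
    (u : (LTCoeff F)ˣ) (hu : LTCoeff.of F π = residueFieldCard F * u) {β : ∀ m, RelNormCoherentUnits hπ (E m)}
    (hβ : ∀ m, (β (m + 1)).baseNorm hπ (hmono (Nat.le_succ m)) = β m) :
    ∃! G : PowerSeries (PowerSeries 𝒪[F]), ∀ m k, ((1 + PowerSeries.X : PowerSeries 𝒪[F]) ^ p ^ m - 1) ∣
      PowerSeries.coeff k G - ∑ i : ZMod (p ^ m), PowerSeries.C ((hθ m).basis.repr
        (PowerSeries.coeff k (relUnitCoordTwo hπ (E m) hq (hE m) hσ₀ u hu (β m)))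
        (((absoluteGaloisGroup.toAlgEquiv F σ₀).restrictNormal (E m)) ^ i.val)) * (1 + PowerSeries.X) ^ i.val := by
  refine existsUnique_series_amice_of_traceCoherent p E hmono hE hdeg hσ₀ hθ hcoh _ fun m k => ?_
  rw [unitBallTrace_coeff_relUnitCoordTwo hπ hq hσ₀ (hmono (Nat.le_succ m)) (hE (m + 1)) u hu (β (m + 1)) k, hβ]

include hdeg in
/-- ★★ **The two-variable Coleman transform is injective on principal families** (`char F = 0`, `u^{[E_m:F]} ≠ 1` for all `m`): two
baseNorm-coherent families of principal units with the same transform are equal (the transform determines the coordinate series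
levelwise by `existsUnique_traceCoherent_of_series`/uniqueness at each level, and these determine `β` by `eq_of_forall_relUnitCoordTwo_eq`).
[cite: deShalit1987, Ch. I §3.7–3.8 (17)] -/
theorem eq_of_colemanTransform₂_eq [CharZero F] [IsAdicComplete (Ideal.span {(p : 𝒪[F])}) 𝒪[F]] (hI : Ideal.span {(p : 𝒪[F])} ≠ ⊤)
    {θ : ∀ m, unitBall (E m)} (hθ : ∀ m, IsIntegralNormalGen (E m) (θ m)) (u : (LTCoeff F)ˣ) (hu : LTCoeff.of F π = residueFieldCard F * u)
    (hud : ∀ m, (u : LTCoeff F) ^ Module.finrank F (E m) ≠ 1) {β β' : ∀ m, RelNormCoherentUnits hπ (E m)}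
    (hβ1 : ∀ m, ‖(((β m).val 0 : unitBall (E m ⊔ ltField π 0 : IntermediateField F (AlgebraicClosure F))) :
      (E m ⊔ ltField π 0 : IntermediateField F (AlgebraicClosure F))) - 1‖ < 1)
    (hβ'1 : ∀ m, ‖(((β' m).val 0 : unitBall (E m ⊔ ltField π 0 : IntermediateField F (AlgebraicClosure F))) :
      (E m ⊔ ltField π 0 : IntermediateField F (AlgebraicClosure F))) - 1‖ < 1)
    (G : PowerSeries (PowerSeries 𝒪[F]))
    (hG : ∀ m k, ((1 + PowerSeries.X : PowerSeries 𝒪[F]) ^ p ^ m - 1) ∣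
      PowerSeries.coeff k G - ∑ i : ZMod (p ^ m), PowerSeries.C ((hθ m).basis.repr
        (PowerSeries.coeff k (relUnitCoordTwo hπ (E m) hq (hE m) hσ₀ u hu (β m)))
        (((absoluteGaloisGroup.toAlgEquiv F σ₀).restrictNormal (E m)) ^ i.val)) * (1 + PowerSeries.X) ^ i.val)
    (hG' : ∀ m k, ((1 + PowerSeries.X : PowerSeries 𝒪[F]) ^ p ^ m - 1) ∣
      PowerSeries.coeff k G - ∑ i : ZMod (p ^ m), PowerSeries.C ((hθ m).basis.repr
        (PowerSeries.coeff k (relUnitCoordTwo hπ (E m) hq (hE m) hσ₀ u hu (β' m)))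
        (((absoluteGaloisGroup.toAlgEquiv F σ₀).restrictNormal (E m)) ^ i.val)) * (1 + PowerSeries.X) ^ i.val) :
    β = β' := by
  refine eq_of_forall_relUnitCoordTwo_eq hπ hq hσ₀ E hE u hu hud hβ1 hβ'1 fun m => PowerSeries.ext fun k => ?_
  -- at level `m`, coefficient `k`: both coordinate vectors are the unique `a` with `ω_m ∣ coeff_k G − Φ_m(a)`
  have huniq := existsUnique_omega_dvd_sub_amice p hI m (PowerSeries.coeff k G)
  have hab : (fun i : ZMod (p ^ m) => (hθ m).basis.repr (PowerSeries.coeff k (relUnitCoordTwo hπ (E m) hq (hE m) hσ₀ u hu (β m)))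
      (((absoluteGaloisGroup.toAlgEquiv F σ₀).restrictNormal (E m)) ^ i.val)) =
      fun i : ZMod (p ^ m) => (hθ m).basis.repr (PowerSeries.coeff k (relUnitCoordTwo hπ (E m) hq (hE m) hσ₀ u hu (β' m)))
      (((absoluteGaloisGroup.toAlgEquiv F σ₀).restrictNormal (E m)) ^ i.val) :=
    huniq.unique (hG m k) (hG' m k)
  refine (hθ m).eq_of_repr_eq fun ρ => ?_
  obtain ⟨i, rfl⟩ := (frobPow_bijective p E hE hdeg hσ₀ m).2 ρ
  exact congrFun hab i

/-! ### The unramified Frobenius is multiplication by `C (1 + X)` -/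

include hE hdeg hσ₀ in
/-- ★ **The Frobenius multiplies the transform by `1 + X`** (coefficientwise `amice_frob`): if `G` is the transform of the trace-coherent
family of series `r`, then `C(1 + X)·G` is the transform of `(r_m^{φ_m})_m` (`φ_m` on coefficients).  So the inner variable `X` is
`φ − 1`: the first variable of the two-variable Iwasawa algebra acting on the coordinate module of the tower.
[cite: deShalit1987, Ch. I §3.1, §3.8 (17)] -/
theorem series_amice_frob {θ : ∀ m, unitBall (E m)} (hθ : ∀ m, IsIntegralNormalGen (E m) (θ m))
    (r : ∀ m, PowerSeries (unitBall (E m))) (G : PowerSeries (PowerSeries 𝒪[F]))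
    (hG : ∀ m k, ((1 + PowerSeries.X : PowerSeries 𝒪[F]) ^ p ^ m - 1) ∣
      PowerSeries.coeff k G - ∑ i : ZMod (p ^ m), PowerSeries.C ((hθ m).basis.repr (PowerSeries.coeff k (r m))
        (((absoluteGaloisGroup.toAlgEquiv F σ₀).restrictNormal (E m)) ^ i.val)) * (1 + PowerSeries.X) ^ i.val) (m k : ℕ) :
    ((1 + PowerSeries.X : PowerSeries 𝒪[F]) ^ p ^ m - 1) ∣
      PowerSeries.coeff k (PowerSeries.C (1 + PowerSeries.X : PowerSeries 𝒪[F]) * G) -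
        ∑ i : ZMod (p ^ m), PowerSeries.C ((hθ m).basis.repr
          (PowerSeries.coeff k (PowerSeries.map (frobUnitBall (E m) σ₀ : unitBall (E m) →+* unitBall (E m)) (r m)))
          (((absoluteGaloisGroup.toAlgEquiv F σ₀).restrictNormal (E m)) ^ i.val)) * (1 + PowerSeries.X) ^ i.val := by
  rw [PowerSeries.coeff_C_mul, PowerSeries.coeff_map]
  exact amice_frob p E hE hdeg hσ₀ hθ (fun m => PowerSeries.coeff k (r m)) (PowerSeries.coeff k G) (fun m => hG m k) m

end TwoVariableTransformTwo

end Literature.NumberTheory.GaloisRepresentations
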